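import Literature.AlgebraicGeometry.Morphisms.FlatOfRegularStalks
import Literature.AlgebraicGeometry.Morphisms.QuasiFiniteStalkPrimary
import HarnessLib

/-!
# A quasi-finite open morphism between regular schemes is flat
# (miracle flatness, Matsumura 23.1 / Stacks 00R4, assembled; dimensions via generizations)

Topic `Literature/AlgebraicGeometry/Morphisms`; namespace `Literature.AlgebraicGeometry.Morphisms`.  THEOREMS ONLY.
Cell hodgecm-mathlib, fan B, row VI-5, package P1 (flatness of the finite quotient `X → X/Δ` for `X`, `X/Δ`
smooth), file P1b-3.  The two hypotheses of `Morphisms.Flat.of_isRegularLocalRing_stalk` (file `FlatOfRegularStalks`)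
that are not about regularity are discharged for a quasi-compact, locally quasi-finite, OPEN morphism `p : X ⟶ Q`:

* `coheight_apply_eq_of_isOpenMap` — `dim 𝒪_{Q,p x} = dim 𝒪_{X,x}` in the form `coheight (p x) = coheight x`
  (the local dimension of a scheme at a point is the coheight of the point for the specialisation order, Mathlib
  `ringKrullDim_stalk_eq_coheight`): `p` is strictly monotone for the specialisation orders (continuity, and the
  fibres are discrete) and generizations lift along `p` (`p` is open with finite fibres: `x ∈ closure p⁻¹{y′}`,
  a finite union of closures of points), so Mathlib's `Order.coheight_eq_of_strictMono` applies.
* `Flat.of_isOpenMap_of_locallyQuasiFinite` — **a quasi-compact, locally quasi-finite, open morphism from a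
  locally Noetherian scheme, with regular stalks on both sides, is flat** (regular stalks of equal dimension +
  `𝔪_{p x}𝒪_{X,x}` primary — `Morphisms.exists_maximalIdeal_pow_le_map_stalkMap` — + Matsumura 23.1).
  The finite quotient `π : X → X/G` by a finite group is open, finite and surjective (tree `RelativeSpec`:
  `IsGeometricQuotient.isOpenMap`, `isFinite_gluedMk`), so this applies to it as soon as `X` and `X/G` are regular.

HC_CM is proved only modulo the 7 printed citations until rung 0 closes; nothing here changes that.

## References
* [Matsumura1987] H. Matsumura, *Commutative Ring Theory*, CUP 1986, Thm. 23.1, Thm. 15.1.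
* The Stacks Project, Tags 00R4 (miracle flatness), 02IZ (`dim 𝒪_{X,x}` and generizations).
-/

noncomputable section

open CategoryTheory AlgebraicGeometry IsLocalRing Topology

universe u

namespace Literature.AlgebraicGeometry.Morphisms

/-- **Generizations lift along an open morphism with finite fibres**: if `y′` generizes `p x` then `y′ = p x′` for
some generization `x′` of `x` (`x` lies in the closure of the finite fibre `p⁻¹{y′}`, which is the union of the
closures of its points). [folklore] -/
private theorem exists_specializes_apply_eq_of_isOpenMap {X Q : Scheme.{u}} (p : X ⟶ Q) [LocallyQuasiFinite p]
    [QuasiCompact p] (hp : IsOpenMap p.base) {x : X} {y' : Q} (h : y' ⤳ p.base x) :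
    ∃ x' : X, x' ⤳ x ∧ p.base x' = y' := by
  have hmem : x ∈ closure (p.base ⁻¹' {y'}) := by
    rw [mem_closure_iff]
    intro U hU hxU
    obtain ⟨u, huU, hub⟩ := h.mem_open (hp U hU) ⟨x, hxU, rfl⟩
    exact ⟨u, huU, hub⟩
  have hfin : (p.base ⁻¹' {y'}).Finite := p.finite_preimage_singleton y'
  have hcl : closure (p.base ⁻¹' {y'}) = ⋃ x' ∈ p.base ⁻¹' {y'}, closure {x'} := by
    conv_lhs => rw [← Set.biUnion_of_singleton (p.base ⁻¹' {y'})]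
    exact hfin.closure_biUnion _
  rw [hcl, Set.mem_iUnion₂] at hmem
  obtain ⟨x', hx', hxx'⟩ := hmem
  exact ⟨x', specializes_iff_mem_closure.mpr hxx', hx'⟩

/-- **A locally quasi-finite morphism is strictly monotone for the specialisation orders** (`a ≤ b ↔ b ⤳ a`):
monotone by continuity, and two comparable points with the same image lie in one discrete fibre, hence coincide.
[folklore] -/
private theorem strictMono_base_of_locallyQuasiFinite {X Q : Scheme.{u}} (p : X ⟶ Q) [LocallyQuasiFinite p] :
    StrictMono p.base := by
  intro a b hab
  obtain ⟨hba, hnab⟩ := lt_iff_le_not_ge.mp hab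
  refine lt_iff_le_not_ge.mpr ⟨(show b ⤳ a from hba).map p.continuous, fun hpab => hnab ?_⟩
  -- `p a = p b`: the two points lie in one (discrete) fibre
  have heq : p.base a = p.base b :=
    ((show b ⤳ a from hba).map p.continuous).antisymm (show p.base a ⤳ p.base b from hpab) |>.eq.symm
  haveI := (p.isDiscrete_preimage_singleton (p.base a)).to_subtype
  have hb : b ∈ p.base ⁻¹' {p.base a} := heq.symm
  have hsp : (⟨b, hb⟩ : p.base ⁻¹' {p.base a}) ⤳ ⟨a, rfl⟩ := (subtype_specializes_iff _ _).mpr hba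
  have hab' : b = a := congrArg Subtype.val (specializes_iff_eq.mp hsp)
  rw [hab']

/-- **`dim 𝒪_{Q,p x} = dim 𝒪_{X,x}` for a quasi-compact, locally quasi-finite, open `p`**, as the equality of
coheights in the specialisation orders (Mathlib `ringKrullDim_stalk_eq_coheight`): `p` is strictly monotone and
generizations lift along it, so `Order.coheight_eq_of_strictMono` applies. [cite: Matsumura1987, Thm. 15.1] -/
theorem coheight_apply_eq_of_isOpenMap {X Q : Scheme.{u}} (p : X ⟶ Q) [LocallyQuasiFinite p]
    [QuasiCompact p] (hp : IsOpenMap p.base) (x : X) :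
    Order.coheight (p.base x) = Order.coheight x := by
  refine (Order.coheight_eq_of_strictMono p.base (strictMono_base_of_locallyQuasiFinite p) ?_ x).symm
  intro a b hab
  obtain ⟨hba, hnab⟩ := lt_iff_le_not_ge.mp hab
  obtain ⟨a', ha'a, ha'b⟩ := exists_specializes_apply_eq_of_isOpenMap p hp (show b ⤳ p.base a from hba)
  refine ⟨a', lt_iff_le_not_ge.mpr ⟨ha'a, fun haa' => hnab ?_⟩, ha'b⟩
  have heq : a' = a := (ha'a.antisymm (show a ⤳ a' from haa')).eq
  rw [← ha'b, heq]

/-- **Miracle flatness for quasi-finite open morphisms of regular schemes**: a quasi-compact, locally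
quasi-finite morphism `p : X ⟶ Q` which is an open map, with `X` locally Noetherian and the stalks `𝒪_{X,x}`,
`𝒪_{Q,p x}` regular for all `x`, is FLAT — Matsumura 23.1 stalkwise (`Flat.of_isRegularLocalRing_stalk`), the
dimensions agreeing by `coheight_apply_eq_of_isOpenMap` and `𝔪_{p x}𝒪_{X,x}` being `𝔪_x`-primary by
quasi-finiteness (`exists_maximalIdeal_pow_le_map_stalkMap`).  Applies to the quotient `X → X/G` of a regular
scheme by a finite group whenever `X/G` is regular. [cite: Matsumura1987, Thm. 23.1] -/
theorem Flat.of_isOpenMap_of_locallyQuasiFinite {X Q : Scheme.{u}} (p : X ⟶ Q) [LocallyQuasiFinite p]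
    [QuasiCompact p] [IsLocallyNoetherian X] (hp : IsOpenMap p.base)
    (hX : ∀ x : X, IsRegularLocalRing (X.presheaf.stalk x))
    (hQ : ∀ x : X, IsRegularLocalRing (Q.presheaf.stalk (p.base x))) : Flat p :=
  Flat.of_isRegularLocalRing_stalk p hX hQ
    (fun x => by
      rw [ringKrullDim_stalk_eq_coheight, ringKrullDim_stalk_eq_coheight,
        coheight_apply_eq_of_isOpenMap p hp x])
    (fun x => exists_maximalIdeal_pow_le_map_stalkMap p x)

end Literature.AlgebraicGeometry.Morphisms

end
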